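import Summits.NavierStokesRegularity.FluidComputer.BlockOpenWindow

/-!
# Block design — the degree/sign no-go for the local form of the exchange gate (bp3 gen 34)

HONEST FRAMING. Low prior, high value-of-information experiment on Tao's machine paradigm; NOT a
claim that NS blows up. This file is a NEGATIVE result at DESIGN level: it proves nothing about
Navier–Stokes and does NOT refute the typed residue `OpenIdeaBound` / `IdeaBound` (whole-tick
shadowing + leakage); it closes one ROUTE to them, for every choice of wavelets.

WHAT IS PROVED (kernel-checked; elementary real algebra and one derivative).
1. `hasDerivAt_regGate`: on rescaled times `σ ∈ (0, 1)` the exchange gate `regGate η r` of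
   `BlockRegulationGate` is the flow of the LINEAR planar field
   `regField η (a, b) = (−(π/2) √η b, (π/2) a / √η)`, of ROTATION TYPE: its off-diagonal entries
   `−(π/2)√η < 0 < (π/2)/√η` have a negative product (`regLin_rotationType`).
2. `QuadField.exists_far_of_rotationType` (the no-go): a planar polynomial vector field of degree
   `≤ 2`, `V (a, b) = a² q₁₁ + ab q₁₂ + b² q₂₂ + a s₁ + b s₂ + c` (`QuadField.eval`), whose linear
   part is SIGN-SYMMETRIC off the diagonal (`(s₁)₂ (s₂)₁ ≥ 0`: e.g. symmetric, or diagonal) is NOT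
   uniformly `ε`-close to a linear field `M` of rotation type (`m₁₂ m₂₁ < 0`) on a half-strip
   `{a > a₀, |b| ≤ b₀}` (`b₀ > 0`) once `ε < |m₁₂| b₀`: some point `p` of the strip has
   `ε < dist (V p) (M p)` (sup metric of `ℝ × ℝ`). Proof: along `b = 0` the second components force
   `(s₁)₂ = m₂₁` EXACTLY (a real quadratic bounded on a half-line has vanishing leading coefficients,
   `quad_coeff_eq_zero`); along `b = ±b₀` the first components force `|(s₂)₁ − m₁₂| b₀ ≤ ε`, so
   `(s₂)₁` has the strict sign of `m₁₂`; then `(s₁)₂ (s₂)₁` has the sign of `m₂₁ m₁₂ < 0`.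
3. `exists_far_regField_of_AinO`: on the OPEN input window `AinO P` of `BlockOpenWindow`
   (`a > aLo − δ` with NO upper bound, `|b| < c0 + δ`) every such `V` is somewhere farther than `ε`
   from `regField η`, for every `ε < (π/2) √η c0`; for the re-tuned `Params.reg` (`c0 = 3/20`,
   `η ≥ 1/2`) this covers every `ε ≤ 1/10` (`exists_far_regField_reg`; numerically the threshold is
   `≥ 0.166`, the kernel-checked bound uses only `π/2 ≥ 1`).

THE DICTIONARY (an ASSUMPTION about true NS — standard, NOT kernel-checked here). At a CLEAN
two-wavelet state `u = recon n (a, b) = a √E_n ψ_n + b √E_{n+1} ψ_{n+1}` (`BlockReadout`), the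
rescaled readout velocity `unit n • W`, `W` the right time-derivative of
`t ↦ read n (u t) = (Re⟪u t, ψ_n⟫/√E_n, Re⟪u t, ψ_{n+1}⟫/√E_{n+1})` along the `H¹⁰_df`-mild solution
(the quantity bounded by the `defect` field of `Literature…FluidComputer.LocalCircuit`), equals
`unit n • read n (−P B(u, u) + ν Δ u)`: as a function of `(a, b)` a polynomial map of degree `≤ 2`
with no constant term, whose linear part `(a, b) ↦ unit n • read n (ν Δ recon n (a, b))` is DIAGONAL
(`Δ` is a Fourier multiplier; `ψ_n`, `ψ_{n+1}` have disjoint Fourier supports) — in particular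
sign-symmetric. Item 2 is stated for the whole sign-symmetric class (any linear part self-adjoint up
to positive rescaling of the two coordinates, any constant forcing term), so nothing hinges on the
particular wavelets, the viscosity or the normalisation.

HONEST READING (for ASSEMBLY §2g.9 / E0 (13)).
(a) WHAT IT CLOSES. The local route of ASSEMBLY §2i — an instantaneous readout-velocity defect
`‖unit n • W − F (read n (u t))‖ ≤ ε` on a working region, turned into whole-tick shadowing by
Grönwall under the budget `ε τc ≤ gronwallBound 0 L ε τc ≤ δsh` (`LocalCircuit.ε_mul_τc_le_δsh`) —
cannot discharge the shadowing half of `OpenIdeaBound` for the conservative exchange gate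
(`F = regField η`, working region `⊇ AinO P`): granted the dictionary, clean states alone force a
defect `> (π/2) √η c0 > 1/10` somewhere on the window (`Params.reg`, `η ≥ 1/2`) against the budget
`ε ≤ δsh / τc = 1/50` of the open circuit+clock of `BlockOpenGate` — FOR EVERY CHOICE OF WAVELETS, by
degree and sign alone (a linear gate transfers in an amplitude-independent time while a Galerkin
velocity is quadratic; the viscous part is diagonal and cannot supply the rotation).
(b) WHAT IT DOES NOT CLOSE. The whole-tick statements `OpenIdeaBound.shadow` / `IdeaBound.shadow`
AS TYPED (tolerance `δsh` over the tick, no pointwise velocity matching) are untouched: this is not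
a refutation of the residue, and `ns_blowup_of_openIdeaBound` keeps its (presumably uninhabited)
hypothesis. It says nothing about gates that are not flows of linear fields, and nothing about the
bounded input window `Ain P` (there the same algebra is only quantitative).
(c) WHERE IT POINTS. A degree-consistent two-block exchange gate must itself be QUADRATIC — the flow
of `(a, b) ↦ k (−η a b, a²)` (conserving `a² + η b²`; transfer time `∝ 1/amplitude`; explicit flow
`a = R sech θ`, `√η b = R tanh θ`, `θ = k √η R σ + θ₀`), i.e. Tao's pump nonlinearity at two modes;
re-inhabiting `DatO` with it and re-deriving the clock is the successor design, whose residue would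
be idea-bound for NS-specific reasons (are the pair's Galerkin coefficients of that shape, with
small leakage?) rather than for the structural reason recorded here.
-/

noncomputable section

open Set Filter Topology

namespace Summit.NavierStokesRegularity.FluidComputer

open Literature.Analysis.FluidPDE Literature.Analysis.FluidPDE.FluidComputer

namespace BlockDesign

/-! ## The generator of the exchange gate -/

section Generator

/-- The linear planar field `(a, b) ↦ (−(π/2) √η b, (π/2) a / √η)` generating the rotation phase
of `regGate η r`. [folklore] -/
def regField (η : ℝ) (p : ℝ × ℝ) : ℝ × ℝ :=
  (-(Real.pi / 2 * Real.sqrt η * p.2), Real.pi / 2 * p.1 / Real.sqrt η)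

/-- On `σ ∈ (0, 1)` the exchange gate is the flow of `regField η`:
`∂_σ regGate η r σ p = regField η (regGate η r σ p)`. [folklore] -/
theorem hasDerivAt_regGate {η : ℝ} (hη : 0 < η) (r : ℝ) (p : ℝ × ℝ) {σ : ℝ} (h0 : 0 < σ)
    (h1 : σ < 1) :
    HasDerivAt (fun σ' => regGate η r σ' p) (regField η (regGate η r σ p)) σ := by
  have hne : Real.sqrt η ≠ 0 := Real.sqrt_ne_zero'.2 hη
  have hk : HasDerivAt (fun x : ℝ => Real.pi / 2 * x) (Real.pi / 2) σ := by
    simpa using (hasDerivAt_id σ).const_mul (Real.pi / 2)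
  have hc := hk.cos
  have hs := hk.sin
  have hF : HasDerivAt (fun σ' : ℝ =>
      (p.1 * Real.cos (Real.pi / 2 * σ') - Real.sqrt η * p.2 * Real.sin (Real.pi / 2 * σ'),
        (p.1 * Real.sin (Real.pi / 2 * σ') + Real.sqrt η * p.2 * Real.cos (Real.pi / 2 * σ')) /
          Real.sqrt η))
      (p.1 * (-Real.sin (Real.pi / 2 * σ) * (Real.pi / 2)) -
          Real.sqrt η * p.2 * (Real.cos (Real.pi / 2 * σ) * (Real.pi / 2)),
        (p.1 * (Real.cos (Real.pi / 2 * σ) * (Real.pi / 2)) +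
            Real.sqrt η * p.2 * (-Real.sin (Real.pi / 2 * σ) * (Real.pi / 2))) / Real.sqrt η) σ :=
    ((hc.const_mul p.1).sub (hs.const_mul (Real.sqrt η * p.2))).prodMk
      (((hs.const_mul p.1).add (hc.const_mul (Real.sqrt η * p.2))).div_const (Real.sqrt η))
  have hev : (fun σ' => regGate η r σ' p) =ᶠ[𝓝 σ] fun σ' : ℝ =>
      (p.1 * Real.cos (Real.pi / 2 * σ') - Real.sqrt η * p.2 * Real.sin (Real.pi / 2 * σ'),
        (p.1 * Real.sin (Real.pi / 2 * σ') + Real.sqrt η * p.2 * Real.cos (Real.pi / 2 * σ')) /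
          Real.sqrt η) := by
    filter_upwards [Ioo_mem_nhds h0 h1] with σ' hσ'
    simp only [regGate, if_pos hσ'.2, max_eq_left hσ'.1.le]
  refine (hF.congr_of_eventuallyEq hev).congr_deriv ?_
  simp only [regField, regGate, if_pos h1, max_eq_left h0.le]
  refine Prod.ext ?_ ?_
  · field_simp
    ring
  · field_simp
    ring

end Generator

/-! ## Planar polynomial fields of degree at most two, and the no-go -/

section Algebra

/-- A real `α` with `|α| x ≤ C` for every `x ≥ 1` vanishes. [folklore] -/
theorem eq_zero_of_abs_mul_le {α C : ℝ} (h : ∀ x : ℝ, 1 ≤ x → |α| * x ≤ C) : α = 0 := by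
  by_contra hα
  have hα' : 0 < |α| := abs_pos.2 hα
  have hC : |α| ≤ C := by simpa using h 1 le_rfl
  have hx : 1 ≤ C / |α| + 1 := by
    have := div_nonneg ((abs_nonneg α).trans hC) hα'.le
    linarith
  have h2 := h (C / |α| + 1) hx
  have h3 : |α| * (C / |α| + 1) = C + |α| := by
    field_simp
  rw [h3] at h2
  linarith

/-- A real quadratic `α a² + β a + γ` bounded on a half-line has `α = β = 0`. [folklore] -/
theorem quad_coeff_eq_zero {α β γ ε a₀ : ℝ}
    (h : ∀ a : ℝ, a₀ < a → |α * a ^ 2 + β * a + γ| ≤ ε) : α = 0 ∧ β = 0 := by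
  have hα : α = 0 := by
    refine eq_zero_of_abs_mul_le (C := 2 * ε) fun x hx => ?_
    have e0 := abs_le.1 (h (a₀ + 1) (by linarith))
    have e1 := abs_le.1 (h (a₀ + 1 + x) (by linarith))
    have e2 := abs_le.1 (h (a₀ + 1 + 2 * x) (by linarith))
    have hsd : (α * (a₀ + 1 + 2 * x) ^ 2 + β * (a₀ + 1 + 2 * x) + γ) -
        2 * (α * (a₀ + 1 + x) ^ 2 + β * (a₀ + 1 + x) + γ) +
        (α * (a₀ + 1) ^ 2 + β * (a₀ + 1) + γ) = 2 * (α * x ^ 2) := by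
      ring
    have hup : α * x ^ 2 ≤ 2 * ε := by linarith
    have hlo : -(2 * ε) ≤ α * x ^ 2 := by linarith
    have hab : |α| * x ^ 2 ≤ 2 * ε := by
      rw [← abs_of_nonneg (pow_two_nonneg x), ← abs_mul]
      exact abs_le.2 ⟨hlo, hup⟩
    have hxx : |α| * x ≤ |α| * x ^ 2 :=
      mul_le_mul_of_nonneg_left (by nlinarith) (abs_nonneg α)
    exact hxx.trans hab
  subst hα
  refine ⟨rfl, eq_zero_of_abs_mul_le (C := 2 * ε) fun x hx => ?_⟩
  have e0 := abs_le.1 (h (a₀ + 1) (by linarith))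
  have e1 := abs_le.1 (h (a₀ + 1 + x) (by linarith))
  have hfd : (0 * (a₀ + 1 + x) ^ 2 + β * (a₀ + 1 + x) + γ) -
      (0 * (a₀ + 1) ^ 2 + β * (a₀ + 1) + γ) = β * x := by
    ring
  have hup : β * x ≤ 2 * ε := by linarith
  have hlo : -(2 * ε) ≤ β * x := by linarith
  rw [← abs_of_nonneg (zero_le_one.trans hx), ← abs_mul]
  exact abs_le.2 ⟨hlo, hup⟩

/-- Planar polynomial vector fields of degree `≤ 2`, by coefficients:
`V (a, b) = a² q₁₁ + ab q₁₂ + b² q₂₂ + a s₁ + b s₂ + c` (`s₁`, `s₂` = the columns of the linear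
part). The readout velocity of a quadratic-plus-linear law at clean two-block states has this form.
[folklore] -/
structure QuadField where
  /-- coefficient of `a²` -/
  q11 : ℝ × ℝ
  /-- coefficient of `ab` -/
  q12 : ℝ × ℝ
  /-- coefficient of `b²` -/
  q22 : ℝ × ℝ
  /-- image of `(1, 0)` under the linear part -/
  s1 : ℝ × ℝ
  /-- image of `(0, 1)` under the linear part -/
  s2 : ℝ × ℝ
  /-- constant term -/
  c : ℝ × ℝ

namespace QuadField

/-- Evaluation of a `QuadField` at `p = (a, b)`. [folklore] -/
def eval (V : QuadField) (p : ℝ × ℝ) : ℝ × ℝ :=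
  (V.q11.1 * p.1 ^ 2 + V.q12.1 * (p.1 * p.2) + V.q22.1 * p.2 ^ 2 + V.s1.1 * p.1 + V.s2.1 * p.2 +
      V.c.1,
    V.q11.2 * p.1 ^ 2 + V.q12.2 * (p.1 * p.2) + V.q22.2 * p.2 ^ 2 + V.s1.2 * p.1 + V.s2.2 * p.2 +
      V.c.2)

/-- SIGN-SYMMETRIC linear part: the off-diagonal entries `(s₁)₂`, `(s₂)₁` have a non-negative
product (self-adjoint up to positive rescaling of the coordinates; diagonal included). [folklore] -/
def SignSymm (V : QuadField) : Prop :=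
  0 ≤ V.s1.2 * V.s2.1

end QuadField

/-- Linear planar fields by matrix entries: `M (a, b) = (m₁₁ a + m₁₂ b, m₂₁ a + m₂₂ b)`.
[folklore] -/
structure LinField where
  /-- entry (1,1) -/
  m11 : ℝ
  /-- entry (1,2) -/
  m12 : ℝ
  /-- entry (2,1) -/
  m21 : ℝ
  /-- entry (2,2) -/
  m22 : ℝ

namespace LinField

/-- Evaluation of a `LinField`. [folklore] -/
def eval (M : LinField) (p : ℝ × ℝ) : ℝ × ℝ :=
  (M.m11 * p.1 + M.m12 * p.2, M.m21 * p.1 + M.m22 * p.2)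

/-- ROTATION TYPE: off-diagonal entries of opposite strict signs. [folklore] -/
def RotationType (M : LinField) : Prop :=
  M.m12 * M.m21 < 0

end LinField

/-- **The degree/sign no-go.** A degree-`≤ 2` planar field with sign-symmetric linear part is not
uniformly `ε`-close, on a half-strip `{a > a₀, |b| ≤ b₀}`, to a linear field of rotation type once
`ε < |m₁₂| b₀`. [folklore] -/
theorem QuadField.exists_far_of_rotationType (V : QuadField) (hV : V.SignSymm) (M : LinField)
    (hM : M.RotationType) {a₀ b₀ ε : ℝ} (hb₀ : 0 < b₀) (hε : ε < |M.m12| * b₀)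
    (W : Set (ℝ × ℝ)) (hW : ∀ a b : ℝ, a₀ < a → |b| ≤ b₀ → (a, b) ∈ W) :
    ∃ p ∈ W, ε < dist (V.eval p) (M.eval p) := by
  by_contra hcon
  push Not at hcon
  -- component bounds at the points `(a, b)` of the strip
  have hcomp : ∀ a b : ℝ, a₀ < a → |b| ≤ b₀ →
      |(V.eval (a, b)).1 - (M.eval (a, b)).1| ≤ ε ∧ |(V.eval (a, b)).2 - (M.eval (a, b)).2| ≤ ε := by
    intro a b ha hb
    have h := hcon (a, b) (hW a b ha hb)
    rw [Prod.dist_eq, Real.dist_eq, Real.dist_eq] at h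
    exact ⟨(le_max_left _ _).trans h, (le_max_right _ _).trans h⟩
  have hb0 : |(0 : ℝ)| ≤ b₀ := by simpa using hb₀.le
  have hbp : |b₀| ≤ b₀ := (abs_of_pos hb₀).le
  have hbm : |(-b₀)| ≤ b₀ := by rw [abs_neg]; exact hbp
  -- ray `b = 0`, second component: `(s₁)₂ = m₂₁`
  have hray : ∀ a : ℝ, a₀ < a → |V.q11.2 * a ^ 2 + (V.s1.2 - M.m21) * a + V.c.2| ≤ ε := by
    intro a ha
    have h := (hcomp a 0 ha hb0).2
    have e : (V.eval (a, 0)).2 - (M.eval (a, 0)).2 =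
        V.q11.2 * a ^ 2 + (V.s1.2 - M.m21) * a + V.c.2 := by
      simp only [QuadField.eval, LinField.eval]
      ring
    rwa [e] at h
  have hs12 : V.s1.2 = M.m21 := by linarith [(quad_coeff_eq_zero hray).2]
  -- lines `b = ±b₀`, first component: `|(s₂)₁ − m₁₂| b₀ ≤ ε`
  have hline : ∀ t : ℝ, |t| ≤ b₀ →
      |V.q22.1 * t ^ 2 + (V.s2.1 - M.m12) * t + V.c.1| ≤ ε := by
    intro t ht
    have hq : ∀ a : ℝ, a₀ < a → |V.q11.1 * a ^ 2 + (V.q12.1 * t + V.s1.1 - M.m11) * a +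
        (V.q22.1 * t ^ 2 + (V.s2.1 - M.m12) * t + V.c.1)| ≤ ε := by
      intro a ha
      have h := (hcomp a t ha ht).1
      have e : (V.eval (a, t)).1 - (M.eval (a, t)).1 = V.q11.1 * a ^ 2 +
          (V.q12.1 * t + V.s1.1 - M.m11) * a + (V.q22.1 * t ^ 2 + (V.s2.1 - M.m12) * t + V.c.1) := by
        simp only [QuadField.eval, LinField.eval]
        ring
      rwa [e] at h
    obtain ⟨h1, h2⟩ := quad_coeff_eq_zero hq
    have h := hq (a₀ + 1) (by linarith)
    rwa [h1, h2, zero_mul, zero_mul, zero_add, zero_add] at h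
  have hp := abs_le.1 (hline b₀ hbp)
  have hm := abs_le.1 (hline (-b₀) hbm)
  have hdiff : (V.q22.1 * b₀ ^ 2 + (V.s2.1 - M.m12) * b₀ + V.c.1) -
      (V.q22.1 * (-b₀) ^ 2 + (V.s2.1 - M.m12) * (-b₀) + V.c.1) = 2 * ((V.s2.1 - M.m12) * b₀) := by
    ring
  have hT : |V.s2.1 - M.m12| * b₀ ≤ ε := by
    rw [← abs_of_pos hb₀, ← abs_mul]
    exact abs_le.2 ⟨by linarith, by linarith⟩
  have hlt : |V.s2.1 - M.m12| < |M.m12| := lt_of_mul_lt_mul_right (hT.trans_lt hε) hb₀.le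
  -- sign bookkeeping: `(s₂)₁` has the sign of `m₁₂`, `(s₁)₂ = m₂₁`, and `m₁₂ m₂₁ < 0`
  have hsq : (V.s2.1 - M.m12) ^ 2 < M.m12 ^ 2 := sq_lt_sq.2 hlt
  have hpos : 0 < V.s2.1 * M.m12 := by nlinarith [sq_nonneg V.s2.1]
  have hm21 : M.m21 ≠ 0 := by
    rintro h0
    simp [LinField.RotationType, h0] at hM
  have hm21sq : 0 < M.m21 ^ 2 := by positivity
  have h1 : 0 ≤ M.m21 * V.s2.1 := by simpa [QuadField.SignSymm, hs12] using hV
  have h2 : M.m12 * M.m21 < 0 := hM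
  nlinarith [mul_nonneg h1 hm21sq.le, mul_pos hpos hm21sq]

end Algebra

/-! ## The no-go on the open input window -/

section Window

variable {S : CascadeSpecs} (P : Params S)

/-- `regField` as a `LinField`. [folklore] -/
def regLin (η : ℝ) : LinField :=
  ⟨0, -(Real.pi / 2 * Real.sqrt η), Real.pi / 2 / Real.sqrt η, 0⟩

/-- `regLin η` evaluates to `regField η`. [folklore] -/
theorem regLin_eval (η : ℝ) (p : ℝ × ℝ) : (regLin η).eval p = regField η p := by
  simp only [LinField.eval, regLin, regField]
  refine Prod.ext ?_ ?_
  · ring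
  · ring

/-- `regField` is of rotation type (`η > 0`). [folklore] -/
theorem regLin_rotationType {η : ℝ} (hη : 0 < η) : (regLin η).RotationType := by
  have hs : 0 < Real.sqrt η := Real.sqrt_pos.2 hη
  have e : (regLin η).m12 * (regLin η).m21 = -((Real.pi / 2) ^ 2) := by
    simp only [regLin]
    field_simp
  rw [LinField.RotationType, e, neg_lt_zero]
  positivity

variable {P}

/-- `(a, b) ∈ AinO` for `aLo − δ < a` and `|b| ≤ c0`. [folklore] -/
theorem mem_AinO_of_abs_le {a b : ℝ} (h1 : P.aLo - P.δ < a) (h2 : |b| ≤ P.c0) :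
    (a, b) ∈ AinO P := by
  refine ⟨(max a P.aLo, b), ⟨Set.mem_Ici.2 (le_max_right a P.aLo), abs_le.1 h2⟩, ?_⟩
  rw [Prod.dist_eq, Real.dist_eq, Real.dist_eq, sub_self, abs_zero]
  refine max_lt ?_ P.δ_pos
  rcases le_or_gt P.aLo a with h | h
  · rw [max_eq_left h, sub_self, abs_zero]; exact P.δ_pos
  · rw [max_eq_right h.le, abs_of_neg (by linarith)]; linarith

variable (P)

/-- **No degree-`≤ 2` sign-symmetric field is `ε`-close to the exchange field on the open input
window** (`ε < (π/2) √η c0`). [folklore] -/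
theorem exists_far_regField_of_AinO (V : QuadField) (hV : V.SignSymm) (hc0 : 0 < P.c0) {ε : ℝ}
    (hε : ε < Real.pi / 2 * Real.sqrt S.eta * P.c0) :
    ∃ p ∈ AinO P, ε < dist (V.eval p) (regField S.eta p) := by
  have hm : |(regLin S.eta).m12| = Real.pi / 2 * Real.sqrt S.eta := by
    simp only [regLin, abs_neg]
    exact abs_of_nonneg (by positivity)
  obtain ⟨p, hp, hfar⟩ := V.exists_far_of_rotationType hV (regLin S.eta)
    (regLin_rotationType S.eta_pos) hc0 (by rwa [hm]) (AinO P)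
    (fun a b ha hb => mem_AinO_of_abs_le ha hb)
  exact ⟨p, hp, by rwa [regLin_eval] at hfar⟩

/-- **The re-tuned instance**: for `Params.reg` (`c0 = 3/20`, `η ≥ 1/2`) every `ε ≤ 1/10` is
exceeded somewhere on `AinO` — against the local-route budget `ε ≤ δsh / τc = 1/50` of the open
conservative circuit+clock. Uses only `π/2 ≥ 1` and `√η > 7/10`. [folklore] -/
theorem exists_far_regField_reg (hS : S.lam0 = 1) (hη : 1 / 2 ≤ S.eta) (V : QuadField)
    (hV : V.SignSymm) {ε : ℝ} (hε : ε ≤ 1 / 10) :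
    ∃ p ∈ AinO (Params.reg S hS hη), ε < dist (V.eval p) (regField S.eta p) := by
  refine exists_far_regField_of_AinO (Params.reg S hS hη) V hV (by norm_num [Params.reg]) ?_
  have h7 : (7 : ℝ) / 10 < Real.sqrt S.eta := by
    rw [Real.lt_sqrt (by norm_num)]
    linarith
  have hpi : (1 : ℝ) ≤ Real.pi / 2 := Real.one_le_pi_div_two
  have hc : (Params.reg S hS hη).c0 = 3 / 20 := rfl
  rw [hc]
  nlinarith [mul_le_mul hpi h7.le (by norm_num) (zero_le_one.trans hpi)]

end Window

end BlockDesign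

end Summit.NavierStokesRegularity.FluidComputer
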